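import Summits.SmoothPoincare4.SmoothPoincare4.Theorems.ConvexBisectionAcyclicBisectionExistsDualHandleModelMap
import HarnessLib

/-!
# Dual handles, IX: the model of the dual handle embedding is injective on `D⁴ ∖ S`
(brick (iv-b) of the sub-goal T3b "the complement of the prefix sub-handlebody is the other piece
with the DUAL suffix handles" of stub `stub_steinRealisation` (NF6), line `modp-braid-orbits` r11,
crux `ConvexBisection.AcyclicBisectionExists`, item stmt-SmoothPoincare4-10508; wave 2, lead c5)

Sequel of `…DualHandleModelMap.lean` (`modelF a κ δ z = (√(𝓅(s)/(1-s)) z_μ, √(q̃(s,u)) z_λ)`).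
The model keeps the directions `ẑ_μ`, `ẑ_λ` and acts on the squared norms by
`Λ (s, u) = (u 𝓅(s), s q̃(s,u))`; here we prove that `Λ` — hence `𝓕` — is injective on the closed
unit ball (`u ≤ 1`), by the case analysis of the V5 report §3.1 (F-inj):

* `gProfile_lt_gProfile` — `g a` is strictly increasing on `(-∞, 1)`;
* `qHat a κ δ p s = ω s (1 + g a (δ (s - p/κ²)) - p) + (1 - ω s) δ s` — the squared `μ`-norm of `𝓕`
  along `{u 𝓅(s) = p}` for `s ≥ 1/4` (`sq_qTilde_eq_qHat`), **strictly increasing in `s`** on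
  `[p/κ², 1)` for `0 ≤ p ≤ κ²`, `κ² + δ < 1` (`qHat_lt_qHat`: a convex combination, with increasing
  weight, of the increasing `F ≥ 1 - κ²` and the increasing `δ s < δ ≤ F`);
* `lamPart_modelF`, `muPart_modelF`, `norm_lamPart_modelF_sq = u 𝓅(s)`, `norm_muPart_modelF_sq = s q̃`;
* **`injOn_modelF`** — `modelF a κ δ` is injective on `{‖z‖ ≤ 1, ‖z_λ‖ < 1} ⊇ D⁴ ∖ S`;
* `helper_injOn_modelF` (registered).

Everything here is proved; no named facts.

## References
* J. Milnor, *Lectures on the h-cobordism theorem* (1965), §3. [MilnorHCobordism1965]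
* A. A. Kosinski, *Differential Manifolds* (1993), VI §6. [Kosinski1993]
-/

noncomputable section

-- the prescribed namespace `Summit.<P>.<Sub>.…` duplicates `SmoothPoincare4` (P = Sub)
set_option linter.dupNamespace false

open scoped Manifold ContDiff Topology

namespace Summit.SmoothPoincare4.SmoothPoincare4.Theorems.AcyclicBisectionExists.ModpBraidOrbits

open Set Function Metric
open Literature.Topology.FourManifolds Literature.Topology.FourManifolds.HandleAttachingMap

/-! ### §1 Monotonicity of the profiles -/

section Mono

/-- `g a` is strictly increasing below `1` (`0 < a`). [folklore] -/
theorem gProfile_lt_gProfile {a t t' : ℝ} (ha : 0 < a) (htt : t < t') (ht' : t' < 1) :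
    gProfile a t < gProfile a t' := by
  unfold gProfile
  have h1 : 0 < 1 - t := by linarith
  have h2 : 0 < 1 - t' := by linarith
  rw [div_lt_div_iff₀ (by linarith) (by linarith)]
  nlinarith [mul_pos ha (sub_pos.2 htt)]

/-- `g a` is monotone below `1` (`0 < a`). [folklore] -/
theorem gProfile_le_gProfile {a t t' : ℝ} (ha : 0 < a) (htt : t ≤ t') (ht' : t' < 1) :
    gProfile a t ≤ gProfile a t' := by
  rcases eq_or_lt_of_le htt with h | h
  · rw [h]
  · exact (gProfile_lt_gProfile ha h ht').le

/-- `ω` is monotone. [folklore] -/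
theorem shellCut_mono {s s' : ℝ} (h : s ≤ s') : shellCut s ≤ shellCut s' :=
  Real.smoothTransition.monotone (by linarith)

/-- **The squared `μ`-norm of `𝓕` along `{u 𝓅(s) = p}`** (for `s ≥ 1/4`):
`ω s (1 + g a (δ (s - p/κ²)) - p) + (1 - ω s) δ s`. [folklore] -/
def qHat (a κ δ p s : ℝ) : ℝ :=
  shellCut s * (1 + gProfile a (δ * (s - p / κ ^ 2)) - p) + (1 - shellCut s) * (δ * s)

/-- `s q̃(s, u) = qHat (κ² s u) s` for `s ≥ 1/4`, `s ≠ 0`. [folklore] -/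
theorem sq_qTilde_eq_qHat {a κ δ s u : ℝ} (hκ : κ ≠ 0) (hs : 1 / 4 ≤ s) :
    s * qTilde a κ δ s u = qHat a κ δ (κ ^ 2 * s * u) s := by
  have hs0 : s ≠ 0 := by intro h; rw [h] at hs; norm_num at hs
  have hκ2 : κ ^ 2 ≠ 0 := pow_ne_zero 2 hκ
  have hA : s * qTilde a κ δ s u = shellCut s * FTop a κ δ s u + (1 - shellCut s) * (δ * s) := by
    unfold qTilde shellCutDiv
    rw [mul_add, ← mul_assoc, ← mul_assoc, mul_div_cancel₀ _ hs0]
    ring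
  have h1 : κ ^ 2 * s * u / κ ^ 2 = s * u := by
    rw [mul_assoc, mul_div_cancel_left₀ _ hκ2]
  have h2 : s - s * u = s * (1 - u) := by ring
  rw [hA, qHat, FTop, h1, h2, mul_assoc]

/-- **`qHat p` is strictly increasing on `[p/κ², 1)`** for `0 ≤ p ≤ κ²`, `κ² + δ < 1`, `0 < δ`, `0 < a`:
a convex combination with non-decreasing weight `ω` of `F(s) = 1 + g a (δ (s - p/κ²)) - p ≥ 1 - κ²`
(non-decreasing) and `δ s` (increasing, `< δ ≤ 1 - κ² ≤ F`). [folklore] -/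
theorem qHat_lt_qHat {a κ δ p s s' : ℝ} (ha : 0 < a) (hκ : 0 < κ) (hδ : 0 < δ) (hκδ : κ ^ 2 + δ < 1)
    (hp : 0 ≤ p) (hpκ : p ≤ κ ^ 2) (hps : p / κ ^ 2 ≤ s) (hss : s < s') (hs' : s' < 1) :
    qHat a κ δ p s < qHat a κ δ p s' := by
  unfold qHat
  set F : ℝ → ℝ := fun t => 1 + gProfile a (δ * (t - p / κ ^ 2)) - p with hF
  have hκ2 : 0 < κ ^ 2 := by positivity
  -- ranges of the arguments of `g`
  have harg0 : 0 ≤ δ * (s - p / κ ^ 2) := mul_nonneg hδ.le (by linarith)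
  have harg1 : δ * (s' - p / κ ^ 2) < 1 := by
    have : s' - p / κ ^ 2 < 1 := by
      have := div_nonneg hp hκ2.le
      linarith
    nlinarith
  have hargle : δ * (s - p / κ ^ 2) ≤ δ * (s' - p / κ ^ 2) := by nlinarith
  -- `F` is non-decreasing from `s` to `s'` and `F s ≥ 1 - κ²`
  have hFmono : F s ≤ F s' := by
    simp only [hF]
    linarith [gProfile_le_gProfile ha hargle harg1]
  have hFs : 1 - κ ^ 2 ≤ F s := by
    simp only [hF]
    have := gProfile_nonneg ha.le harg0 (lt_of_le_of_lt hargle harg1)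
    linarith
  have hω := shellCut_mono hss.le
  have hω0 := (shellCut_mem s).1
  have hω1 := (shellCut_mem s').2
  -- the difference, regrouped
  have key : shellCut s' * F s' + (1 - shellCut s') * (δ * s') - (shellCut s * F s + (1 - shellCut s) * (δ * s)) =
      shellCut s' * (F s' - F s) + (1 - shellCut s') * (δ * s' - δ * s) + (shellCut s' - shellCut s) * (F s - δ * s) := by
    ring
  have hδs : δ * s < F s := by
    have : δ * s < δ := by nlinarith
    linarith
  have h3 : 0 ≤ (shellCut s' - shellCut s) * (F s - δ * s) := mul_nonneg (by linarith) (by linarith)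
  have h1 : 0 ≤ shellCut s' * (F s' - F s) := mul_nonneg (by linarith [(shellCut_mem s').1]) (by linarith)
  -- strictness: either the weight `1 - ω s'` is positive, or `ω s' = 1` and `F` is strictly increasing
  rcases lt_or_eq_of_le hω1 with hlt | heq
  · have h2 : 0 < (1 - shellCut s') * (δ * s' - δ * s) := mul_pos (by linarith) (by nlinarith)
    show shellCut s * F s + (1 - shellCut s) * (δ * s) < shellCut s' * F s' + (1 - shellCut s') * (δ * s')
    linarith
  · have hFlt : F s < F s' := by
      simp only [hF]
      have := gProfile_lt_gProfile ha (by nlinarith : δ * (s - p / κ ^ 2) < δ * (s' - p / κ ^ 2)) harg1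
      linarith
    have h1' : 0 < shellCut s' * (F s' - F s) := by rw [heq, one_mul]; linarith
    have h2 : 0 ≤ (1 - shellCut s') * (δ * s' - δ * s) := by rw [heq]; simp
    show shellCut s * F s + (1 - shellCut s) * (δ * s) < shellCut s' * F s' + (1 - shellCut s') * (δ * s')
    linarith

end Mono

/-! ### §2 The parts of `𝓕 z` and injectivity -/

section Inj

/-- The `λ`-part of `𝓕 z`: `√(𝓅(s)/(1-s)) z_μ`. [folklore] -/
theorem lamPart_modelF (a κ δ : ℝ) (z : EuclideanSpace ℝ (Fin 4)) :
    lamPart (modelF a κ δ z) = Real.sqrt (pFun κ (sOf z) / (1 - sOf z)) • muPart z := by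
  rw [modelF, lamPart_add, lamPart_smul, lamPart_smul, lamPart_lamEmbed, lamPart_muEmbed, smul_zero, add_zero]

/-- The `μ`-part of `𝓕 z`: `√(q̃(s,u)) z_λ`. [folklore] -/
theorem muPart_modelF (a κ δ : ℝ) (z : EuclideanSpace ℝ (Fin 4)) :
    muPart (modelF a κ δ z) = Real.sqrt (qTilde a κ δ (sOf z) (uOf z)) • lamPart z := by
  rw [modelF, muPart_add, muPart_smul, muPart_smul, muPart_lamEmbed, muPart_muEmbed, smul_zero, zero_add]

/-- `‖(𝓕 z)_λ‖² = u 𝓅(s)` (on `s < 1`, `κ > 0`). [folklore] -/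
theorem norm_lamPart_modelF_sq {a κ δ : ℝ} (hκ : 0 < κ) {z : EuclideanSpace ℝ (Fin 4)} (hz : sOf z < 1) :
    ‖lamPart (modelF a κ δ z)‖ ^ 2 = uOf z * pFun κ (sOf z) := by
  have hp : 0 ≤ pFun κ (sOf z) / (1 - sOf z) := div_nonneg (pFun_pos hκ (sq_nonneg _)).le (by linarith)
  rw [lamPart_modelF, norm_smul, mul_pow, Real.norm_of_nonneg (Real.sqrt_nonneg _), Real.sq_sqrt hp, uOf]
  field_simp

/-- `‖(𝓕 z)_μ‖² = s q̃(s,u)` (where `q̃ > 0`). [folklore] -/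
theorem norm_muPart_modelF_sq {a κ δ : ℝ} {z : EuclideanSpace ℝ (Fin 4)} (hq : 0 < qTilde a κ δ (sOf z) (uOf z)) :
    ‖muPart (modelF a κ δ z)‖ ^ 2 = sOf z * qTilde a κ δ (sOf z) (uOf z) := by
  rw [muPart_modelF, norm_smul, mul_pow, Real.norm_of_nonneg (Real.sqrt_nonneg _), Real.sq_sqrt hq.le, sOf]
  ring

/-- On the closed unit ball `u ≤ 1`. [folklore] -/
theorem uOf_le_one {z : EuclideanSpace ℝ (Fin 4)} (hz : ‖z‖ ≤ 1) (hs : sOf z < 1) : uOf z ≤ 1 := by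
  rw [uOf, div_le_one (by linarith)]
  have h := norm_sq_eq_lamPart_muPart z
  have h1 : ‖z‖ ^ 2 ≤ 1 := by nlinarith [norm_nonneg z]
  unfold sOf; linarith

/-- On the top zone `s > 1/2` of the ball, `s q̃ > δ/2` (a convex combination of `F ≥ 1 - κ² > δ/2`
and `δ s > δ/2`). [folklore] -/
theorem sq_qTilde_gt {a κ δ : ℝ} (ha : 0 < a) (hκ : 0 < κ) (hκ2 : κ ≤ 1 / 2) (hδ : 0 < δ) (hδ2 : δ ≤ 1 / 2)
    {w : EuclideanSpace ℝ (Fin 4)} (hw : ‖w‖ ≤ 1) (hsw : sOf w < 1) (hhalf : 1 / 2 < sOf w) :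
    δ * (1 / 2) < sOf w * qTilde a κ δ (sOf w) (uOf w) := by
  have hsw0 : (1 : ℝ) / 4 ≤ sOf w := by linarith
  have hs0 : 0 ≤ sOf w := sq_nonneg _
  rw [sq_qTilde_eq_qHat hκ.ne' hsw0, qHat]
  have huw := uOf_le_one hw hsw
  have huw0 := uOf_nonneg hsw
  have hκ2' : 0 < κ ^ 2 := by positivity
  have h1u : 0 ≤ κ ^ 2 * sOf w * (1 - uOf w) := mul_nonneg (mul_nonneg hκ2'.le hs0) (by linarith)
  have hsu : sOf w * uOf w ≤ 1 := mul_le_one₀ hsw.le huw0 huw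
  have hp0 : 0 ≤ κ ^ 2 * sOf w * uOf w := by positivity
  have hpκ : κ ^ 2 * sOf w * uOf w ≤ κ ^ 2 := by nlinarith
  have hdiv : κ ^ 2 * sOf w * uOf w / κ ^ 2 = sOf w * uOf w := by
    rw [mul_assoc, mul_div_cancel_left₀ _ hκ2'.ne']
  rw [hdiv]
  have harg : 0 ≤ δ * (sOf w - sOf w * uOf w) := mul_nonneg hδ.le (by nlinarith)
  have harg1 : δ * (sOf w - sOf w * uOf w) < 1 := by
    have : sOf w - sOf w * uOf w ≤ sOf w := by nlinarith
    nlinarith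
  have hF : 1 - κ ^ 2 ≤ 1 + gProfile a (δ * (sOf w - sOf w * uOf w)) - κ ^ 2 * sOf w * uOf w := by
    have := gProfile_nonneg ha.le harg harg1; linarith
  have hω0 := (shellCut_mem (sOf w)).1
  have hω1 := (shellCut_mem (sOf w)).2
  have hκ4 : κ ^ 2 ≤ 1 / 4 := by nlinarith
  have h1 : δ * (1 / 2) < 1 + gProfile a (δ * (sOf w - sOf w * uOf w)) - κ ^ 2 * sOf w * uOf w := by linarith
  have h2 : δ * (1 / 2) < δ * sOf w := by nlinarith
  nlinarith [mul_nonneg hω0 (sub_nonneg.2 h1.le), mul_nonneg (sub_nonneg.2 hω1) (sub_nonneg.2 h2.le)]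

/-- **`𝓕` IS INJECTIVE ON `{‖z‖ ≤ 1, ‖z_λ‖ < 1} ⊇ D⁴ ∖ S`** (`0 < a`, `0 < κ ≤ 1/2`, `0 < δ ≤ 1/2`).  Equal
images have equal squared part-norms `(u 𝓅(s), s q̃)`; the case analysis `s, s' ≤ 1/2` (`s q̃ = δ s`),
`s ≤ 1/2 < s'` (`δ s ≤ δ/2 < s' q̃`), `s, s' > 1/2` (`qHat` strictly increasing at the common `p`) gives
`s = s'`, then `u = u'` (`𝓅 > 0`), and the parts are equal up to the SAME positive scalars.
[cite: MilnorHCobordism1965, §3] -/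
theorem injOn_modelF {a κ δ : ℝ} (ha : 0 < a) (hκ : 0 < κ) (hκ2 : κ ≤ 1 / 2) (hδ : 0 < δ) (hδ2 : δ ≤ 1 / 2) :
    InjOn (modelF a κ δ) {z | ‖z‖ ≤ 1 ∧ sOf z < 1} := by
  intro z hz z' hz' heq
  have hκδ : κ ^ 2 + δ < 1 := by nlinarith
  have hκ2' : 0 < κ ^ 2 := by positivity
  have hu := uOf_le_one hz.1 hz.2
  have hu' := uOf_le_one hz'.1 hz'.2
  have hu0 := uOf_nonneg hz.2
  have hu0' := uOf_nonneg hz'.2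
  have hs0 : 0 ≤ sOf z := sq_nonneg _
  have hs0' : 0 ≤ sOf z' := sq_nonneg _
  have hq := qTilde_pos ha hκ hκ2 hδ hδ2 hs0 hz.2 hu0 hu
  have hq' := qTilde_pos ha hκ hκ2 hδ hδ2 hs0' hz'.2 hu0' hu'
  -- equal part-norms
  have hP : uOf z * pFun κ (sOf z) = uOf z' * pFun κ (sOf z') := by
    rw [← norm_lamPart_modelF_sq hκ hz.2, ← norm_lamPart_modelF_sq hκ hz'.2, heq]
  have hQ : sOf z * qTilde a κ δ (sOf z) (uOf z) = sOf z' * qTilde a κ δ (sOf z') (uOf z') := by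
    rw [← norm_muPart_modelF_sq hq, ← norm_muPart_modelF_sq hq', heq]
  -- `s = s'`
  have hs : sOf z = sOf z' := by
    rcases le_or_gt (sOf z) (1 / 2) with h | h <;> rcases le_or_gt (sOf z') (1 / 2) with h' | h'
    · rw [qTilde_of_le a κ δ h, qTilde_of_le a κ δ h'] at hQ
      nlinarith
    · exfalso
      have h1 := sq_qTilde_gt ha hκ hκ2 hδ hδ2 hz'.1 hz'.2 h'
      rw [qTilde_of_le a κ δ h] at hQ
      nlinarith
    · exfalso
      have h1 := sq_qTilde_gt ha hκ hκ2 hδ hδ2 hz.1 hz.2 h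
      rw [qTilde_of_le a κ δ h'] at hQ
      nlinarith
    · -- both on the top zone: `𝓅 = κ² s`, common `p`, strict monotonicity of `qHat p`
      have hz14 : (1 : ℝ) / 4 ≤ sOf z := by linarith
      have hz14' : (1 : ℝ) / 4 ≤ sOf z' := by linarith
      rw [pFun_of_ge κ hz14, pFun_of_ge κ hz14'] at hP
      have hp' : κ ^ 2 * sOf z' * uOf z' = κ ^ 2 * sOf z * uOf z := by linarith
      rw [sq_qTilde_eq_qHat hκ.ne' hz14, sq_qTilde_eq_qHat hκ.ne' hz14', hp'] at hQ
      have hp0 : 0 ≤ κ ^ 2 * sOf z * uOf z := by positivity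
      have hsu : sOf z * uOf z ≤ 1 := mul_le_one₀ hz.2.le hu0 hu
      have hpκ : κ ^ 2 * sOf z * uOf z ≤ κ ^ 2 := by nlinarith
      have hdiv : κ ^ 2 * sOf z * uOf z / κ ^ 2 = sOf z * uOf z := by
        rw [mul_assoc, mul_div_cancel_left₀ _ hκ2'.ne']
      have hps : κ ^ 2 * sOf z * uOf z / κ ^ 2 ≤ sOf z := by rw [hdiv]; nlinarith
      have hps' : κ ^ 2 * sOf z * uOf z / κ ^ 2 ≤ sOf z' := by
        rw [hdiv]
        have : sOf z * uOf z = sOf z' * uOf z' := by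
          have := hp'; field_simp at this; linarith
        rw [this]; nlinarith
      by_contra hne
      rcases lt_or_gt_of_ne hne with hlt | hlt
      · exact absurd hQ (ne_of_lt (qHat_lt_qHat ha hκ hδ hκδ hp0 hpκ hps hlt hz'.2))
      · exact absurd hQ.symm (ne_of_lt (qHat_lt_qHat ha hκ hδ hκδ hp0 hpκ hps' hlt hz.2))
  -- `u = u'`
  have huu : uOf z = uOf z' := by
    rw [← hs] at hP
    exact mul_right_cancel₀ (pFun_pos hκ hs0).ne' hP
  -- the parts
  have hμ : muPart z = muPart z' := by
    have h1 := congrArg lamPart heq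
    rw [lamPart_modelF, lamPart_modelF, ← hs] at h1
    exact smul_right_injective _ (Real.sqrt_pos.2 (div_pos (pFun_pos hκ hs0) (by linarith [hz.2]))).ne' h1
  have hl : lamPart z = lamPart z' := by
    have h1 := congrArg muPart heq
    rw [muPart_modelF, muPart_modelF, ← hs, ← huu] at h1
    exact smul_right_injective _ (Real.sqrt_pos.2 hq).ne' h1
  rw [← lamEmbed_add_muEmbed z, ← lamEmbed_add_muEmbed z', hl, hμ]

/-- **Registered helper `helper_injOn_modelF` (brick (iv-b) of T3b, sub-goal of NF6
`stub_steinRealisation`, wave 2, lead c5): the model of the dual handle embedding is injective on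
`{‖z‖ ≤ 1, ‖z_λ‖ < 1} ⊇ D⁴ ∖ S`.** [cite: MilnorHCobordism1965, §3] -/
theorem helper_injOn_modelF : ∀ {a κ δ : ℝ}, 0 < a → 0 < κ → κ ≤ 1 / 2 → 0 < δ → δ ≤ 1 / 2 → Set.InjOn (Summit.SmoothPoincare4.SmoothPoincare4.Theorems.AcyclicBisectionExists.ModpBraidOrbits.modelF a κ δ) {z : EuclideanSpace ℝ (Fin 4) | ‖z‖ ≤ 1 ∧ Summit.SmoothPoincare4.SmoothPoincare4.Theorems.AcyclicBisectionExists.ModpBraidOrbits.sOf z < 1} :=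
  fun ha hκ hκ2 hδ hδ2 => injOn_modelF ha hκ hκ2 hδ hδ2

end Inj

end Summit.SmoothPoincare4.SmoothPoincare4.Theorems.AcyclicBisectionExists.ModpBraidOrbits

end
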